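import Literature.MathematicalPhysics.QuantumFieldTheory.Balaban1983to89.B8Thm4ExistsAtGamma
import Literature.MathematicalPhysics.QuantumFieldTheory.Balaban1983to89.B8Thm4SupportLocalBdryG

/-!
# `Balaban1983to89.B8Thm4ExistsAtGammaG` — [Balaban1985RegularSpaces] THEOREM 4 (p. 88), EXISTENCE HALF, in the leaf's quantifier shape, edition γ,
# **WITH `G`-VALUED GAUGE TRANSFORMATIONS** (print p. 76 «G = SU(N)»): `B8Thm4ExistsAtGamma.thm4Exists_concrete_at_γ` re-run over ym3-torus's `G`-valued
# engine `B8Thm4SupportLocalBdryG.thm4_exists_all_levels_supp_landau138_γ_mem`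

statement-level skeleton of published theorems with citation tags; proofs where landed; nothing here is a claim about the
Yang–Mills mass gap

T. Bałaban, *Spaces of regular gauge field configurations on a lattice and gauge fixing conditions*, Commun. Math. Phys. **99** (1985) 75–102
`[Balaban1985RegularSpaces]` ("B8"): Thm 4 p. 88, (1.29) p. 81, (1.31) p. 82, (1.35) p. 82, (1.38) p. 82, (1.58)–(1.62) pp. 86–87, (1.66) p. 87, Prop. 5
(1.107)–(1.108) p. 94, p. 76 («we consider … G = SU(N)»); T. Bałaban, *Propagators and renormalization transformations … II*, CMP **96** (1984) 223–250
`[Balaban1984PropagatorsII]` (2.3) p. 224.  STATUS: published, refereed.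

CITATION HEADER (lean-in-tree rule).  Cell `pub-ymgap` (HUMAN RULING D-0062, Track A), DAG node N05 = [B8], seat `pub-ymgap-dag-n05-e` g33 (the Prop-6 γ-crown
authoring lineage), CROSS-CELL SERVICE for cell `ym3-torus` (LEAD-H ★ym-ust-19200-w5 g6, line H-P6J of crux stmt-QuantumFields-19200; pub-ymgap bus XCELL-1∕2,
INTENT-G1): file (F1) of the `G`-valued re-run of this seat's γ chain `B8Thm4ExistsAtGamma → … → B8Prop6CubeMemberScalarGammaHolds`.  WHAT IS REPRODUCED.
★ `thm4Exists_concrete_at_γ_mem` — `B8Thm4ExistsAtGamma.thm4Exists_concrete_at_γ` (this seat, g10) VERBATIM (statement and proof: the three windows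
`thm4_windows` ∕ `thm4_windows_extra` ∕ `thm4_windows_γ`, one threshold, the datum's laws `hbox hclass hlay`, (1.35) in print's class, the exterior-collar
allowance `B_∂`, the (1.59) socket `H59` unitary as in the engine) except: a subgroup `(G : Subgroup 𝔸ˣ) (hG : G ≤ unitaryUnits 𝔸)` is a parameter, the two
Proposition-5 sockets ask for ∕ deliver `G`-valued `v` (the step socket may assume `u₁ ∈ G`), and the CONCLUSION carries `∀ x, u x ∈ G`; the engine call is
re-pointed to `B8Thm4SupportLocalBdryG.thm4_exists_all_levels_supp_landau138_γ_mem` (cell ym3-torus, seat ym-ust-19936-w8 g5, p678402).  By-name twin; no new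
analysis.  Kind «kernel-checked proof», theorems only: no `def`, no `… : Prop` fact, no `instance`, no `notation`, no existing module modified.
`--supports stmt-QuantumFields-19200` (ym3-torus's crux; count-neutral for both cells).

HONEST SCOPE ∕ A6.  Exactly as `B8Thm4ExistsAtGamma`: the two Proposition-5 bodies and the (1.59) body are HYPOTHESES at the datum (discharged two files up the
chain by the τ-free bodies `B8SockHFPTraceFree.sockHFP₀_body_of_join_RD_traceFree` ∕ `B8SockHFP59GammaTraceFree.sockHFP_body_of_join_59_γ_traceFree` and by the
flat (1.59) line); nothing of [B8] is asserted here; N05's Track-A status (DISCHARGED OF RECORD, director-ym №237) is untouched; rung R3 (YM₃ on T³) is ym3-torus's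
and NOT the Clay problem; pub-ymgap is one finite 𝕋⁴ programme at fixed ε; nothing continuum ∕ ℝ⁴ ∕ OS ∕ mass-gap ∕ Clay.  No `sorry`, no `def`.
-/

noncomputable section
open NormedSpace

namespace Literature.MathematicalPhysics.QuantumFieldTheory.Balaban1983to89.B8Thm4ExistsAtGammaG

open Complex (I)
open MatrixLog B7Prop1Explicit B7Prop2Explicit B7Prop1Local B7Eq92Concrete
open B7Prop2Explicit (C0 c2')
open B7Prop3Flat (c3)
open B8Ineq132 (covDerivFwd InAk BondTouches)
open B8Eq119TwistedAxial (Restr129 InAx)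
open B8Eq184Proof (gaugeExp cfgExp)
open B8Lemma1NonAbelian (mulCfg)
open B8Eq140Level (SideTouches)
open B8Eq146AExpansion (iEta)
open B7Prop4GeneralLevels (logCovIter linCovIter)
open B8Eq155JBound (Jcur wsup)
open B8ScaledSupNorm (bondNorm msup)
open B8Thm2LogB (blockTop)
open B8Ineq130 (tlo thi)
open B8Eq138LandauZd (IsLandau138W logCfg)
open B8Prop3GaugeFixedKLevel (eq_mgauge_inv_of_mgauge_eq mem_unitaryUnits_of_mgauge_eq logField_spec)
open B8Thm4SupportLocalBdryG (thm4_exists_all_levels_supp_landau138_γ_mem)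
open B8Thm4Windows (thm4_windows thm4_windows_extra)
open B8Thm4ExistsConcreteGamma (thm4_windows_γ)
open B9SupplySockB9P3ZdBeta (CrossB)

-- `Site` alone could resolve to the torus sites of `Setup.lean`; re-export the `ℤ^d` sites of `B7Prop1Explicit`.
export B7Prop1Explicit (Site)

variable {d : ℕ}

variable {𝔸 : Type*} [CStarAlgebra 𝔸] [Nontrivial 𝔸]

/-- ★ **THEOREM 4 (p. 88), EXISTENCE HALF, IN THE LEAF's QUANTIFIER SHAPE, THREE SOCKET BODIES AT THE DATUM, EDITION γ, `G`-VALUED GAUGE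
TRANSFORMATIONS** — `B8Thm4ExistsAtGamma.thm4Exists_concrete_at_γ` VERBATIM except: the subgroup `G ≤ U(𝔸)` is a parameter, Proposition 5's two socket
bodies ask for ∕ deliver `G`-valued `v` (the step body may assume `u₁ ∈ G`), and the conclusion's `u` is `G`-valued (`∀ x, u x ∈ G`) — print p. 76 «we
consider … G = SU(N)»: every gauge transformation of Theorem 4's induction `u₀ = 1`, `u_{m+1} = u_m·v` lies in `G` when Proposition 5 delivers `G`-valued
`e^{iλ}`.  Datum laws `hbox hclass hlay`, (1.35) in print's class, the exterior-collar allowance `B_∂`, the unitary (1.59) socket, the threshold and the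
(1.62)-shape conclusion `Lʲη|(1∕iη) log U′^{u⁻¹}| ≤ 5dLB₀(α₀+α₁)` are byte-identical with the unitary edition.  Engine: ym3-torus's
`B8Thm4SupportLocalBdryG.thm4_exists_all_levels_supp_landau138_γ_mem` at `a := α₁ ≤ dLα₁`.
[cite: Balaban1985RegularSpaces, Thm 4 p.88, (1.29) p.81, (1.31) p.82, (1.35) p.82, (1.38) p.82, (1.58)–(1.62) pp.86–87, (1.66) p.87, Prop. 5 (1.107)–(1.108) p.94, pp.94–95, p.76, p.77; Balaban1984PropagatorsII, (2.3) p.224] -/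
theorem thm4Exists_concrete_at_γ_mem (hd2 : 2 ≤ d) {L : ℕ} (hL : 2 ≤ L) (G : Subgroup 𝔸ˣ) (hG : G ≤ unitaryUnits 𝔸)
    {B₀ B₀' Bbd : ℝ} (hB₀ : 0 < B₀) (hB₀' : 0 < B₀') (hB : 2 ≤ 5 * (d : ℝ) * L * B₀) (hBbd : 0 ≤ Bbd) (hBd : 4 * Bbd ≤ ((d : ℝ) * L - 1) * B₀) :
    ∃ c₁ : ℝ, 0 < c₁ ∧ ∀ (η : ℝ), 0 < η → ∀ (k : ℕ)
    (Ω : ℕ → Set (Site d)) (hΩ : ∀ j, Ω (j + 1) ⊆ Ω j) (Λs : ℕ → ℕ → Set (Site d)) (Λb : ℕ → ℕ → Set (Site d × Fin d))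
    -- PRINT's box law (edition γ): the locality box of a level-`j` datum bond lies in `Ω_{j−1}` ((1.31); level 0: `Ω₀`)
    (hbox : ∀ m, m ≤ k → ∀ j, j ≤ m → ∀ c ∈ Λb m j, ∀ x, InBox (loK L j c.1) (bondHiK L j c.1 c.2) x → x ∈ Ω (j - 1))
    (hclass : ∀ m, m ≤ k → ∀ j, j ≤ m → ∀ c ∈ Λb m j,
      (c.1 ∈ Λs m j ∧ c.1 + e c.2 ∈ Λs m j) ∨
      (∃ j', j = j' + 1 ∧ (∀ x, (L : ℤ) • c.1 ≤ x → x ≤ (L : ℤ) • c.1 + blockTop L → x ∈ Λs m j') ∧ c.1 + e c.2 ∈ Λs m j) ∨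
      (∃ j', j = j' + 1 ∧ c.1 ∈ Λs m j ∧ (∀ x, (L : ℤ) • (c.1 + e c.2) ≤ x → x ≤ (L : ℤ) • (c.1 + e c.2) + blockTop L → x ∈ Λs m j')))
    -- the boundary-layer law of the datum's region: a site of `Ω₀` with a sup-distance-1 neighbour outside lies in `Λs m 0`, `1 ≤ m ≤ k`
    (hlay : ∀ m, 1 ≤ m → m ≤ k → ∀ y z : Site d, y ∈ Ω 0 → z ∉ Ω 0 → (∀ i, y i - 1 ≤ z i ∧ z i ≤ y i + 1) → y ∈ Λs m 0),
      ∀ α₀ α₁ : ℝ, 0 < α₀ → 0 < α₁ → α₀ + α₁ ≤ c₁ →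
      ∀ U₀ U' : Site d → Fin d → 𝔸ˣ, (∀ x κ, U₀ x κ ∈ unitaryUnits 𝔸) → (∀ x κ, U' x κ ∈ unitaryUnits 𝔸) →
      InAk L k η α₀ Ω U₀ → InAk L k η α₀ Ω (mulCfg U' U₀) → (∀ m, m ≤ k → InAx L m (Λs m) U₀ (mulCfg U' U₀)) →
      -- (1.35) for the datum in PRINT's class: every level-`j` bond whose box lies in `Ω_{j−1}` (p. 77 «at least one end-point in Ω»)
      (∀ j, j ≤ k → ∀ (z : Site d) (μ : Fin d), (∀ x, InBox (loK L j z) (bondHiK L j z μ) x → x ∈ Ω (j - 1)) →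
        ‖(avgIter L (mulCfg U' U₀) j z μ : 𝔸) - (avgIter L U₀ j z μ : 𝔸)‖ ≤ α₁) →
      (∀ b ∈ {b : Site d × Fin d | SideTouches (Ω 0) b.1 b.2}, ‖((U' b.1 b.2 : 𝔸ˣ) : 𝔸) - 1‖ ≤ α₁) →
      -- Proposition 5's fixed point at the base level, over THIS datum
      ((∃ (v : Site d → 𝔸ˣ) (lam : Site d → 𝔸), (∀ x, v x ∈ G) ∧ (∀ x, x ∉ Ω 0 → v x = 1) ∧
        (∀ j, j ≤ 1 → ∀ b ∈ {b : Site d × Fin d | SideTouches (Ω j) b.1 b.2}, (v b.1 : 𝔸) = ((gaugeExp lam b.1 : 𝔸ˣ) : 𝔸) ∧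
        (v (b.1 + e b.2) : 𝔸) = ((gaugeExp lam (b.1 + e b.2) : 𝔸ˣ) : 𝔸)) ∧
        (∀ j, j ≤ 1 → ∀ b ∈ {b : Site d × Fin d | SideTouches (Ω j) b.1 b.2},
        ‖lam b.1‖ ≤ (8 * B₀' * (5 * (d : ℝ) * L * B₀) * (α₀ + α₁)) ∧ ((L : ℝ) ^ j * η) * ‖covDerivFwd η U₀ b.2 lam b.1‖ ≤ (8 * B₀' * (5 * (d : ℝ) * L * B₀) * (α₀ + α₁))) ∧
        IsLandau138W L 1 η (Ω 0) (Λs 1) U₀ (mgauge U₀ v⁻¹ U') ∧ Restr129 L 1 (Λs 1) U₀ ((1 : Site d → 𝔸ˣ) * v))) →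
      -- Proposition 5's fixed point at every intermediate level, over THIS datum
      ((∀ m, 1 ≤ m → m < k → ∀ (u₁ : Site d → 𝔸ˣ) (U₁ : Site d → Fin d → 𝔸ˣ) (A : Site d → Fin d → 𝔸),
        (∀ x, u₁ x ∈ G) → (∀ x, x ∉ Ω 0 → u₁ x = 1) → mgauge U₀ u₁ U₁ = U' → Restr129 L m (Λs m) U₀ u₁ →
        IsLandau138W L m η (Ω 0) (Λs m) U₀ U₁ →
        (∀ j, j ≤ m → ∀ b ∈ {b : Site d × Fin d | SideTouches (Ω j) b.1 b.2},
        U₁ b.1 b.2 = cfgExp η A b.1 b.2 ∧ IsSelfAdjoint (A b.1 b.2) ∧ ‖A b.1 b.2‖ ≤ (5 * (d : ℝ) * L * B₀ * (α₀ + α₁)) * ((L : ℝ) ^ j * η)⁻¹) →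
        ∃ (v : Site d → 𝔸ˣ) (lam : Site d → 𝔸), (∀ x, v x ∈ G) ∧ (∀ x, x ∉ Ω 0 → v x = 1) ∧
        (∀ j, j ≤ m + 1 → ∀ b ∈ {b : Site d × Fin d | SideTouches (Ω j) b.1 b.2}, (v b.1 : 𝔸) = ((gaugeExp lam b.1 : 𝔸ˣ) : 𝔸) ∧
        (v (b.1 + e b.2) : 𝔸) = ((gaugeExp lam (b.1 + e b.2) : 𝔸ˣ) : 𝔸)) ∧
        (∀ j, j ≤ m + 1 → ∀ b ∈ {b : Site d × Fin d | SideTouches (Ω j) b.1 b.2},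
        ‖lam b.1‖ ≤ (8 * B₀' * (5 * (d : ℝ) * L * B₀) * (α₀ + α₁)) ∧ ((L : ℝ) ^ j * η) * ‖covDerivFwd η U₀ b.2 lam b.1‖ ≤ (8 * B₀' * (5 * (d : ℝ) * L * B₀) * (α₀ + α₁))) ∧
        IsLandau138W L (m + 1) η (Ω 0) (Λs (m + 1)) U₀ (mgauge U₀ v⁻¹ U₁) ∧ Restr129 L (m + 1) (Λs (m + 1)) U₀ (u₁ * v))) →
      -- (1.59) for the fields gauge-related to THIS `U′` over THIS `U₀`
      ((∀ m, 1 ≤ m → m ≤ k → ∀ (u : Site d → 𝔸ˣ) (W : Site d → Fin d → 𝔸ˣ) (A' : Site d → Fin d → 𝔸),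
        (∀ x, u x ∈ unitaryUnits 𝔸) → (∀ x, x ∉ Ω 0 → u x = 1) → mgauge U₀ u W = U' → Restr129 L m (Λs m) U₀ u →
        IsLandau138W L m η (Ω 0) (Λs m) U₀ W → (∀ y τ, IsSelfAdjoint (A' y τ)) →
        (∀ j, j ≤ m → ∀ y τ, SideTouches (Ω j) y τ →
        W y τ = cfgExp η A' y τ ∧ ‖A' y τ‖ ≤ (2 * (L * (5 * (d : ℝ) * L * B₀ * (α₀ + α₁))) + 8 * (8 * B₀' * (5 * (d : ℝ) * L * B₀) * (α₀ + α₁))) * ((L : ℝ) ^ j * η)⁻¹) →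
        (∀ y τ, (∀ j, j ≤ m → ¬ SideTouches (Ω j) y τ) → A' y τ = 0) →
        msup L m η (-(1 : ℝ)) (fun j (b : Site d × Fin d) => SideTouches (Ω j) b.1 b.2) (fun b => A' b.1 b.2)
        ≤ B₀ * (bondNorm L m η (-(3 : ℝ)) Ω (fun x μ => Jcur η U₀ A' μ x)
        + wsup 1 (fun p : {p : ℕ × (Site d × Fin d) // p.1 ≤ m ∧ (p.2 ∈ Λb m p.1 ∨ (p.1 = 0 ∧ CrossB (Ω 0) p.2))} =>
        linCovIter L U₀ (iEta η A') p.1.1 p.1.2.1 p.1.2.2))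
        + Bbd * msup L m η (-(1 : ℝ)) (fun j (b : Site d × Fin d) => j = 0 ∧ SideTouches (Ω 0) b.1 b.2 ∧ ¬ BondTouches (Ω 0) b.1 b.2)
            (fun b => A' b.1 b.2) ∧
        msup L m η (-(2 : ℝ)) (fun j (t : Fin d × Fin d × Site d) => SideTouches (Ω j) t.2.2 t.2.1)
        (fun t => covDerivFwd η U₀ t.1 (fun z => A' z t.2.1) t.2.2)
        ≤ B₀ * (bondNorm L m η (-(3 : ℝ)) Ω (fun x μ => Jcur η U₀ A' μ x)
        + wsup 1 (fun p : {p : ℕ × (Site d × Fin d) // p.1 ≤ m ∧ (p.2 ∈ Λb m p.1 ∨ (p.1 = 0 ∧ CrossB (Ω 0) p.2))} =>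
        linCovIter L U₀ (iEta η A') p.1.1 p.1.2.1 p.1.2.2))
        + Bbd * msup L m η (-(1 : ℝ)) (fun j (b : Site d × Fin d) => j = 0 ∧ SideTouches (Ω 0) b.1 b.2 ∧ ¬ BondTouches (Ω 0) b.1 b.2)
            (fun b => A' b.1 b.2))) →
      ∃ u : Site d → 𝔸ˣ, (∀ x, u x ∈ G) ∧ (∀ x, x ∉ Ω 0 → u x = 1) ∧ Restr129 L k (Λs k) U₀ u ∧
        (1 ≤ k → IsLandau138W L k η (Ω 0) (Λs k) U₀ (mgauge U₀ u⁻¹ U')) ∧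
        (∀ j, j ≤ k → ∀ b ∈ {b : Site d × Fin d | SideTouches (Ω j) b.1 b.2},
          mgauge U₀ u⁻¹ U' b.1 b.2 = cfgExp η (logCfg η (mgauge U₀ u⁻¹ U')) b.1 b.2 ∧
            IsSelfAdjoint (logCfg η (mgauge U₀ u⁻¹ U') b.1 b.2) ∧
            ‖logCfg η (mgauge U₀ u⁻¹ U') b.1 b.2‖ ≤ (5 * (d : ℝ) * L * B₀ * (α₀ + α₁)) * ((L : ℝ) ^ j * η)⁻¹) := by
  have hL1 : 1 ≤ L := le_trans (by norm_num) hL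
  have hd1 : 1 ≤ d := le_trans (by norm_num) hd2
  have hL' : (1 : ℝ) ≤ L := by exact_mod_cast hL1
  have hd' : (1 : ℝ) ≤ d := by exact_mod_cast hd1
  obtain ⟨c₁, hc₁, hw⟩ := thm4_windows hd1 hL1 hB₀ hB₀' hB
  obtain ⟨c₂, hc₂, hw'⟩ := thm4_windows_extra (d := d) hL1
  obtain ⟨c₃, hc₃γ, hwγ⟩ := thm4_windows_γ hd1 hL1 hB₀ hB₀' hB
  refine ⟨min (min c₁ c₂) c₃, lt_min (lt_min hc₁ hc₂) hc₃γ, ?_⟩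
  intro η hη k Ω hΩ Λs Λb hbox hclass hlay α₀ α₁ hα₀ hα₁ hS U₀ U' hU₀ hU' h33 h34 hAx h135 h66 P5base P5 H59
  have hS1 : α₀ + α₁ ≤ c₁ := hS.trans ((min_le_left _ _).trans (min_le_left _ _))
  have hS2 : α₀ + α₁ ≤ c₂ := hS.trans ((min_le_left _ _).trans (min_le_right _ _))
  have hS3 : α₀ + α₁ ≤ c₃ := hS.trans (min_le_right _ _)
  have hS0 : 0 ≤ α₀ + α₁ := by linarith
  obtain ⟨w1, w2, w3, w4, w5, w6, w7, w8, w9, w10, w11, w12, w13, w14, w15, w16, w17, w18⟩ :=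
    hw α₀ α₁ hα₀ hα₁ hS1 (5 * (d : ℝ) * L * B₀ * (α₀ + α₁)) (8 * B₀' * (5 * (d : ℝ) * L * B₀) * (α₀ + α₁)) rfl rfl
  obtain ⟨w19, w20⟩ := hw' α₀ α₁ hα₀ hα₁ hS2
  obtain ⟨g5, g6, g7, g9, g10, g13, g14⟩ :=
    hwγ α₀ α₁ hα₀ hα₁ hS3 (5 * (d : ℝ) * L * B₀ * (α₀ + α₁)) (8 * B₀' * (5 * (d : ℝ) * L * B₀) * (α₀ + α₁)) rfl rfl
  have hcs0 : 0 ≤ 5 * (d : ℝ) * L * B₀ * (α₀ + α₁) := by positivity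
  have hα₄0 : 0 ≤ 8 * B₀' * (5 * (d : ℝ) * L * B₀) * (α₀ + α₁) := by positivity
  -- the exterior-collar window at the datum's (1.66)₀ level `a := α₁`
  have hbdry : 4 * Bbd * α₁ ≤ ((d : ℝ) * L - 1) * B₀ * (α₀ + α₁) := by
    have h1 : 4 * Bbd * α₁ ≤ ((d : ℝ) * L - 1) * B₀ * α₁ := mul_le_mul_of_nonneg_right hBd hα₁.le
    have h2 : 0 ≤ ((d : ℝ) * L - 1) * B₀ := le_trans (by positivity) hBd
    have h3 : ((d : ℝ) * L - 1) * B₀ * α₁ ≤ ((d : ℝ) * L - 1) * B₀ * (α₀ + α₁) :=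
      mul_le_mul_of_nonneg_left (le_add_of_nonneg_left hα₀.le) h2
    exact h1.trans h3
  -- EXISTENCE (support form, `G`-valued) at the top level `k`, ym3-torus's edition-γ `G`-engine, sockets AT THE DATUM passed through
  obtain ⟨u, hu, huS, h129, W, hW, hLan, A, hA⟩ := thm4_exists_all_levels_supp_landau138_γ_mem hd2 hη hL k G hG hU₀ hU'
    hα₀ hα₁ hα₄0 hB₀.le rfl w1 w2 w3 w4 g5 g6 g7 w7 w8 g9 g10 w11 w12 w19 hBbd hα₁.le hbdry g13 g14 Ω hΩ Λs Λb hbox hclass h33 h34 hAx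
    h135 h66 hlay (le_mul_of_one_le_left hα₁.le (one_le_mul_of_one_le_of_one_le hd' hL')) P5base P5 H59 k le_rfl
  have hWeq : W = mgauge U₀ u⁻¹ U' := eq_mgauge_inv_of_mgauge_eq hW
  have hWu : ∀ x κ, W x κ ∈ unitaryUnits 𝔸 := mem_unitaryUnits_of_mgauge_eq hU₀ hU' (fun x => hG (hu x)) hW
  -- `c⋆ ≤ 1/16` for the logarithm device
  have hc16 : 5 * (d : ℝ) * L * B₀ * (α₀ + α₁) ≤ 1 / 16 := by
    have h₁ : (1 : ℝ) * (5 * (d : ℝ) * L * B₀ * (α₀ + α₁)) ≤ L * (5 * (d : ℝ) * L * B₀ * (α₀ + α₁)) :=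
      mul_le_mul_of_nonneg_right hL' hcs0
    linarith
  -- the exponent read back as `logCfg`
  have hleaf : ∀ j, j ≤ k → ∀ b ∈ {b : Site d × Fin d | SideTouches (Ω j) b.1 b.2},
      mgauge U₀ u⁻¹ U' b.1 b.2 = cfgExp η (logCfg η (mgauge U₀ u⁻¹ U')) b.1 b.2 ∧
        IsSelfAdjoint (logCfg η (mgauge U₀ u⁻¹ U') b.1 b.2) ∧
        ‖logCfg η (mgauge U₀ u⁻¹ U') b.1 b.2‖ ≤ (5 * (d : ℝ) * L * B₀ * (α₀ + α₁)) * ((L : ℝ) ^ j * η)⁻¹ := by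
    intro j hj b hb
    obtain ⟨hexp, -, hbd⟩ := hA j hj b hb
    have hbd' : ‖A b.1 b.2‖ ≤ (5 * (d : ℝ) * L * B₀ * (α₀ + α₁)) * η⁻¹ := by
      refine hbd.trans ?_
      have hLj : (1 : ℝ) ≤ (L : ℝ) ^ j := one_le_pow₀ hL'
      have : ((L : ℝ) ^ j * η)⁻¹ ≤ η⁻¹ := by
        rw [mul_inv]
        calc ((L : ℝ) ^ j)⁻¹ * η⁻¹ ≤ 1 * η⁻¹ := by gcongr; exact inv_le_one_of_one_le₀ hLj
          _ = η⁻¹ := one_mul _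
      exact mul_le_mul_of_nonneg_left this hcs0
    obtain ⟨hlogA, hsa, hWexp⟩ := logField_spec hη U₀ hWu hexp hbd' hc16
    rw [← hWeq]
    refine ⟨hWexp, ?_, ?_⟩
    · simpa [logCfg] using hsa
    · show ‖logCfg η W b.1 b.2‖ ≤ _
      rw [logCfg, hlogA]
      exact hbd
  exact ⟨u, hu, huS, h129, fun hk => hWeq ▸ hLan hk, hleaf⟩

#print axioms thm4Exists_concrete_at_γ_mem

end Literature.MathematicalPhysics.QuantumFieldTheory.Balaban1983to89.B8Thm4ExistsAtGammaG

end
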